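import Summits.Ventures.YMGap.RobustBall.StringTensionOnBallW
import Summits.Ventures.YMGap.RobustBall.AreaLawRowsSU3PV2
import HarnessLib

/-!
# Venture YMGap, track Y2 ROBUST-BALL — `SU(3)` STRING TENSION ON THE BALL, HYPOTHESIS-FREE to `β_W = 12/25`: the infinite-volume reading of the
# centred Schwinger–Dyson (PV2) area-law rows (`AreaLawRowsSU3PV2`), `d = 4`, tiers 1 and 2

HONEST FRAMING.  Venture file of the cell `pub-ymgap` (QuantumFields programme), seat engine-2 (g10); 0 compute.  Strong-coupling LATTICE
statements only; nothing about the continuum, a spectral mass gap, weak coupling, or Clay.  rb-p2's `suFundStringTension_ge_onBall` /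
`suFundStringTension_ge_onBallW` (tree: every `N`; input an `AreaLawOnBall(W) N 4 β … ` row BY NAME) turn each TORUS area-law row into a statement about
every INFINITE-VOLUME LIMIT STATE `μ` of every eventually-member family `𝓦` of the ball (`perturbedLimitPoints β 𝓦`, non-empty by compactness): ONE pair
`(C, c)`, `c > 0`, with the `ℤ⁴` area law `HasAreaLawWith μ χ₃ C c` (`χ₃ = (1/3) Re tr`) and `c ≤ suFundStringTension 3 μ` WHENEVER the string tension of
`μ` exists (existence NOT asserted: a generic member is not reflection positive).  This file records the `SU(3)` HYPOTHESIS-FREE instances (class K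
outright) on this seat's PV2 pair-door rows `RobustBallPV.su3_pv2Row4_*` / `su3_pv2RowW4_*` from `β_W = 1/4` on:
* TIER 1 (`ClusterDomainFR (2ε) ε r`, every `r`, every `mv ≥ 1`), `(β_W; ε₀, ε₁)`: (1/4; .596, .298) (3/10; .470, .235) (1/3; .386, .193) (3/8; .282, .141) (2/5; .218, .109) (21/50; .166, .083) (43/100; .142, .071) (9/20; .090, .045) (23/50; .062, .031) (47/100; .036, .018) (12/25; .010, .005);
* TIER 2 (`ClusterDomain (log 6/5) (2ε) ε`, every `mv ≥ 1`): (1/4; .570, .285) (3/10; .442, .221) (1/3; .356, .178) (3/8; .250, .125) (2/5; .184, .092) (21/50; .132, .066) (43/100; .106, .053) (9/20; .054, .027).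
WHAT MOVES: the hypothesis-free `SU(3)` string-tension-on-the-ball instances of `StringTensionOnBallSU3PV` (engine-2 g9) reached `β_W = 43/100` (tier 1) and
`2/5` (tier 2); here they reach `12/25` (tier 1) and `9/20` (tier 2), with larger balls at every common coupling (`1/4`: `(0.596, 0.298)` vs
`(0.546, 0.273)`).  The CONDITIONAL instances (H1 ∧ H2, to `11/20` / `3/4`) are untouched.  Also the SEGMENT forms
`su3_pv2Row4_upTo_12_25` (ONE ball `(1/100, 1/200)` for ALL `0 ≤ β_W ≤ 12/25`) and `su3_stringTension_onBall_pv2_upTo_12_25`.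
-/

noncomputable section

open MeasureTheory Filter Topology
open Literature.MathematicalPhysics.QuantumLattice
open Literature.MathematicalPhysics.QuantumFieldTheory hiding ZdEdge Site
open Literature.Barriers.QuantumFields (suFundStringTension)
open Summit.Ventures.YMGap.RobustBall
open Summit.Ventures.YMGap.RobustBallPV (su3_areaLawOnBall_pv2)

namespace Summit.Ventures.YMGap.RobustBallPV

/-! ### Tier 1 (`ClusterDomainFR (2ε) ε r`) -/

/-- **`SU(3)`, `d = 4`, `β_W = 1/4`, ball `(ε₀, ε₁) = (.596, .298)`, HYPOTHESIS-FREE: string tension on the ball** — one `c > 0` such that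
every infinite-volume limit state `μ` of every eventually-member family satisfies `HasAreaLawWith μ χ₃ C c` and, whenever its string tension exists,
`c ≤ suFundStringTension 3 μ`.  Input: `su3_pv2Row4_1_4`. [folklore] -/
theorem su3_stringTension_onBall_pv2_1_4 (r : ℕ) {mv : ℕ} (hmv : 1 ≤ mv) :
    ∃ C c : ℝ, 0 < c ∧ ∀ 𝓦 : PerturbationFamily 4 3,
      (∀ᶠ L : ℕ in atTop, 𝓦 L ∈ ClusterDomainFR (2 * (149 / 500)) (149 / 500) r ∧ IsSlabLocal mv (𝓦 L)) →
        ∀ μ ∈ perturbedLimitPoints ((1 / 4 : ℝ) / 3) 𝓦,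
          HasAreaLawWith μ (fun g => normalisedCharacter 3 (fundamentalRep (Fin 3) g)) C c ∧
          ((∃ σ : ℝ, HasStringTension μ (fun g => normalisedCharacter 3 (fundamentalRep (Fin 3) g)) σ) →
            c ≤ suFundStringTension 3 μ) :=
  suFundStringTension_ge_onBall (su3_pv2Row4_1_4 r hmv)

/-- **`SU(3)`, `d = 4`, `β_W = 3/10`, ball `(ε₀, ε₁) = (.470, .235)`, HYPOTHESIS-FREE: string tension on the ball** — one `c > 0` such that
every infinite-volume limit state `μ` of every eventually-member family satisfies `HasAreaLawWith μ χ₃ C c` and, whenever its string tension exists,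
`c ≤ suFundStringTension 3 μ`.  Input: `su3_pv2Row4_3_10`. [folklore] -/
theorem su3_stringTension_onBall_pv2_3_10 (r : ℕ) {mv : ℕ} (hmv : 1 ≤ mv) :
    ∃ C c : ℝ, 0 < c ∧ ∀ 𝓦 : PerturbationFamily 4 3,
      (∀ᶠ L : ℕ in atTop, 𝓦 L ∈ ClusterDomainFR (2 * (47 / 200)) (47 / 200) r ∧ IsSlabLocal mv (𝓦 L)) →
        ∀ μ ∈ perturbedLimitPoints ((3 / 10 : ℝ) / 3) 𝓦,
          HasAreaLawWith μ (fun g => normalisedCharacter 3 (fundamentalRep (Fin 3) g)) C c ∧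
          ((∃ σ : ℝ, HasStringTension μ (fun g => normalisedCharacter 3 (fundamentalRep (Fin 3) g)) σ) →
            c ≤ suFundStringTension 3 μ) :=
  suFundStringTension_ge_onBall (su3_pv2Row4_3_10 r hmv)

/-- **`SU(3)`, `d = 4`, `β_W = 1/3`, ball `(ε₀, ε₁) = (.386, .193)`, HYPOTHESIS-FREE: string tension on the ball** — one `c > 0` such that
every infinite-volume limit state `μ` of every eventually-member family satisfies `HasAreaLawWith μ χ₃ C c` and, whenever its string tension exists,
`c ≤ suFundStringTension 3 μ`.  Input: `su3_pv2Row4_1_3`. [folklore] -/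
theorem su3_stringTension_onBall_pv2_1_3 (r : ℕ) {mv : ℕ} (hmv : 1 ≤ mv) :
    ∃ C c : ℝ, 0 < c ∧ ∀ 𝓦 : PerturbationFamily 4 3,
      (∀ᶠ L : ℕ in atTop, 𝓦 L ∈ ClusterDomainFR (2 * (193 / 1000)) (193 / 1000) r ∧ IsSlabLocal mv (𝓦 L)) →
        ∀ μ ∈ perturbedLimitPoints ((1 / 3 : ℝ) / 3) 𝓦,
          HasAreaLawWith μ (fun g => normalisedCharacter 3 (fundamentalRep (Fin 3) g)) C c ∧
          ((∃ σ : ℝ, HasStringTension μ (fun g => normalisedCharacter 3 (fundamentalRep (Fin 3) g)) σ) →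
            c ≤ suFundStringTension 3 μ) :=
  suFundStringTension_ge_onBall (su3_pv2Row4_1_3 r hmv)

/-- **`SU(3)`, `d = 4`, `β_W = 3/8`, ball `(ε₀, ε₁) = (.282, .141)`, HYPOTHESIS-FREE: string tension on the ball** — one `c > 0` such that
every infinite-volume limit state `μ` of every eventually-member family satisfies `HasAreaLawWith μ χ₃ C c` and, whenever its string tension exists,
`c ≤ suFundStringTension 3 μ`.  Input: `su3_pv2Row4_3_8`. [folklore] -/
theorem su3_stringTension_onBall_pv2_3_8 (r : ℕ) {mv : ℕ} (hmv : 1 ≤ mv) :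
    ∃ C c : ℝ, 0 < c ∧ ∀ 𝓦 : PerturbationFamily 4 3,
      (∀ᶠ L : ℕ in atTop, 𝓦 L ∈ ClusterDomainFR (2 * (141 / 1000)) (141 / 1000) r ∧ IsSlabLocal mv (𝓦 L)) →
        ∀ μ ∈ perturbedLimitPoints ((3 / 8 : ℝ) / 3) 𝓦,
          HasAreaLawWith μ (fun g => normalisedCharacter 3 (fundamentalRep (Fin 3) g)) C c ∧
          ((∃ σ : ℝ, HasStringTension μ (fun g => normalisedCharacter 3 (fundamentalRep (Fin 3) g)) σ) →
            c ≤ suFundStringTension 3 μ) :=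
  suFundStringTension_ge_onBall (su3_pv2Row4_3_8 r hmv)

/-- **`SU(3)`, `d = 4`, `β_W = 2/5`, ball `(ε₀, ε₁) = (.218, .109)`, HYPOTHESIS-FREE: string tension on the ball** — one `c > 0` such that
every infinite-volume limit state `μ` of every eventually-member family satisfies `HasAreaLawWith μ χ₃ C c` and, whenever its string tension exists,
`c ≤ suFundStringTension 3 μ`.  Input: `su3_pv2Row4_2_5`. [folklore] -/
theorem su3_stringTension_onBall_pv2_2_5 (r : ℕ) {mv : ℕ} (hmv : 1 ≤ mv) :
    ∃ C c : ℝ, 0 < c ∧ ∀ 𝓦 : PerturbationFamily 4 3,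
      (∀ᶠ L : ℕ in atTop, 𝓦 L ∈ ClusterDomainFR (2 * (109 / 1000)) (109 / 1000) r ∧ IsSlabLocal mv (𝓦 L)) →
        ∀ μ ∈ perturbedLimitPoints ((2 / 5 : ℝ) / 3) 𝓦,
          HasAreaLawWith μ (fun g => normalisedCharacter 3 (fundamentalRep (Fin 3) g)) C c ∧
          ((∃ σ : ℝ, HasStringTension μ (fun g => normalisedCharacter 3 (fundamentalRep (Fin 3) g)) σ) →
            c ≤ suFundStringTension 3 μ) :=
  suFundStringTension_ge_onBall (su3_pv2Row4_2_5 r hmv)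

/-- **`SU(3)`, `d = 4`, `β_W = 21/50`, ball `(ε₀, ε₁) = (.166, .083)`, HYPOTHESIS-FREE: string tension on the ball** — one `c > 0` such that
every infinite-volume limit state `μ` of every eventually-member family satisfies `HasAreaLawWith μ χ₃ C c` and, whenever its string tension exists,
`c ≤ suFundStringTension 3 μ`.  Input: `su3_pv2Row4_21_50`. [folklore] -/
theorem su3_stringTension_onBall_pv2_21_50 (r : ℕ) {mv : ℕ} (hmv : 1 ≤ mv) :
    ∃ C c : ℝ, 0 < c ∧ ∀ 𝓦 : PerturbationFamily 4 3,
      (∀ᶠ L : ℕ in atTop, 𝓦 L ∈ ClusterDomainFR (2 * (83 / 1000)) (83 / 1000) r ∧ IsSlabLocal mv (𝓦 L)) →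
        ∀ μ ∈ perturbedLimitPoints ((21 / 50 : ℝ) / 3) 𝓦,
          HasAreaLawWith μ (fun g => normalisedCharacter 3 (fundamentalRep (Fin 3) g)) C c ∧
          ((∃ σ : ℝ, HasStringTension μ (fun g => normalisedCharacter 3 (fundamentalRep (Fin 3) g)) σ) →
            c ≤ suFundStringTension 3 μ) :=
  suFundStringTension_ge_onBall (su3_pv2Row4_21_50 r hmv)

/-- **`SU(3)`, `d = 4`, `β_W = 43/100`, ball `(ε₀, ε₁) = (.142, .071)`, HYPOTHESIS-FREE: string tension on the ball** — one `c > 0` such that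
every infinite-volume limit state `μ` of every eventually-member family satisfies `HasAreaLawWith μ χ₃ C c` and, whenever its string tension exists,
`c ≤ suFundStringTension 3 μ`.  Input: `su3_pv2Row4_43_100`. [folklore] -/
theorem su3_stringTension_onBall_pv2_43_100 (r : ℕ) {mv : ℕ} (hmv : 1 ≤ mv) :
    ∃ C c : ℝ, 0 < c ∧ ∀ 𝓦 : PerturbationFamily 4 3,
      (∀ᶠ L : ℕ in atTop, 𝓦 L ∈ ClusterDomainFR (2 * (71 / 1000)) (71 / 1000) r ∧ IsSlabLocal mv (𝓦 L)) →
        ∀ μ ∈ perturbedLimitPoints ((43 / 100 : ℝ) / 3) 𝓦,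
          HasAreaLawWith μ (fun g => normalisedCharacter 3 (fundamentalRep (Fin 3) g)) C c ∧
          ((∃ σ : ℝ, HasStringTension μ (fun g => normalisedCharacter 3 (fundamentalRep (Fin 3) g)) σ) →
            c ≤ suFundStringTension 3 μ) :=
  suFundStringTension_ge_onBall (su3_pv2Row4_43_100 r hmv)

/-- **`SU(3)`, `d = 4`, `β_W = 9/20`, ball `(ε₀, ε₁) = (.090, .045)`, HYPOTHESIS-FREE: string tension on the ball** — one `c > 0` such that
every infinite-volume limit state `μ` of every eventually-member family satisfies `HasAreaLawWith μ χ₃ C c` and, whenever its string tension exists,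
`c ≤ suFundStringTension 3 μ`.  Input: `su3_pv2Row4_9_20`. [folklore] -/
theorem su3_stringTension_onBall_pv2_9_20 (r : ℕ) {mv : ℕ} (hmv : 1 ≤ mv) :
    ∃ C c : ℝ, 0 < c ∧ ∀ 𝓦 : PerturbationFamily 4 3,
      (∀ᶠ L : ℕ in atTop, 𝓦 L ∈ ClusterDomainFR (2 * (9 / 200)) (9 / 200) r ∧ IsSlabLocal mv (𝓦 L)) →
        ∀ μ ∈ perturbedLimitPoints ((9 / 20 : ℝ) / 3) 𝓦,
          HasAreaLawWith μ (fun g => normalisedCharacter 3 (fundamentalRep (Fin 3) g)) C c ∧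
          ((∃ σ : ℝ, HasStringTension μ (fun g => normalisedCharacter 3 (fundamentalRep (Fin 3) g)) σ) →
            c ≤ suFundStringTension 3 μ) :=
  suFundStringTension_ge_onBall (su3_pv2Row4_9_20 r hmv)

/-- **`SU(3)`, `d = 4`, `β_W = 23/50`, ball `(ε₀, ε₁) = (.062, .031)`, HYPOTHESIS-FREE: string tension on the ball** — one `c > 0` such that
every infinite-volume limit state `μ` of every eventually-member family satisfies `HasAreaLawWith μ χ₃ C c` and, whenever its string tension exists,
`c ≤ suFundStringTension 3 μ`.  Input: `su3_pv2Row4_23_50`. [folklore] -/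
theorem su3_stringTension_onBall_pv2_23_50 (r : ℕ) {mv : ℕ} (hmv : 1 ≤ mv) :
    ∃ C c : ℝ, 0 < c ∧ ∀ 𝓦 : PerturbationFamily 4 3,
      (∀ᶠ L : ℕ in atTop, 𝓦 L ∈ ClusterDomainFR (2 * (31 / 1000)) (31 / 1000) r ∧ IsSlabLocal mv (𝓦 L)) →
        ∀ μ ∈ perturbedLimitPoints ((23 / 50 : ℝ) / 3) 𝓦,
          HasAreaLawWith μ (fun g => normalisedCharacter 3 (fundamentalRep (Fin 3) g)) C c ∧
          ((∃ σ : ℝ, HasStringTension μ (fun g => normalisedCharacter 3 (fundamentalRep (Fin 3) g)) σ) →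
            c ≤ suFundStringTension 3 μ) :=
  suFundStringTension_ge_onBall (su3_pv2Row4_23_50 r hmv)

/-- **`SU(3)`, `d = 4`, `β_W = 47/100`, ball `(ε₀, ε₁) = (.036, .018)`, HYPOTHESIS-FREE: string tension on the ball** — one `c > 0` such that
every infinite-volume limit state `μ` of every eventually-member family satisfies `HasAreaLawWith μ χ₃ C c` and, whenever its string tension exists,
`c ≤ suFundStringTension 3 μ`.  Input: `su3_pv2Row4_47_100`. [folklore] -/
theorem su3_stringTension_onBall_pv2_47_100 (r : ℕ) {mv : ℕ} (hmv : 1 ≤ mv) :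
    ∃ C c : ℝ, 0 < c ∧ ∀ 𝓦 : PerturbationFamily 4 3,
      (∀ᶠ L : ℕ in atTop, 𝓦 L ∈ ClusterDomainFR (2 * (9 / 500)) (9 / 500) r ∧ IsSlabLocal mv (𝓦 L)) →
        ∀ μ ∈ perturbedLimitPoints ((47 / 100 : ℝ) / 3) 𝓦,
          HasAreaLawWith μ (fun g => normalisedCharacter 3 (fundamentalRep (Fin 3) g)) C c ∧
          ((∃ σ : ℝ, HasStringTension μ (fun g => normalisedCharacter 3 (fundamentalRep (Fin 3) g)) σ) →
            c ≤ suFundStringTension 3 μ) :=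
  suFundStringTension_ge_onBall (su3_pv2Row4_47_100 r hmv)

/-- **`SU(3)`, `d = 4`, `β_W = 12/25`, ball `(ε₀, ε₁) = (.010, .005)`, HYPOTHESIS-FREE: string tension on the ball** — one `c > 0` such that
every infinite-volume limit state `μ` of every eventually-member family satisfies `HasAreaLawWith μ χ₃ C c` and, whenever its string tension exists,
`c ≤ suFundStringTension 3 μ`.  Input: `su3_pv2Row4_12_25`. [folklore] -/
theorem su3_stringTension_onBall_pv2_12_25 (r : ℕ) {mv : ℕ} (hmv : 1 ≤ mv) :
    ∃ C c : ℝ, 0 < c ∧ ∀ 𝓦 : PerturbationFamily 4 3,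
      (∀ᶠ L : ℕ in atTop, 𝓦 L ∈ ClusterDomainFR (2 * (1 / 200)) (1 / 200) r ∧ IsSlabLocal mv (𝓦 L)) →
        ∀ μ ∈ perturbedLimitPoints ((12 / 25 : ℝ) / 3) 𝓦,
          HasAreaLawWith μ (fun g => normalisedCharacter 3 (fundamentalRep (Fin 3) g)) C c ∧
          ((∃ σ : ℝ, HasStringTension μ (fun g => normalisedCharacter 3 (fundamentalRep (Fin 3) g)) σ) →
            c ≤ suFundStringTension 3 μ) :=
  suFundStringTension_ge_onBall (su3_pv2Row4_12_25 r hmv)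

/-! ### Tier 2 (`ClusterDomain (log 6/5) (2ε) ε`) -/

/-- **`SU(3)`, `d = 4`, `β_W = 1/4`, TIER-2 ball `ClusterDomain (log 6/5) (.570) (.285)`, HYPOTHESIS-FREE**: the same reading, from
`su3_pv2RowW4_1_4`. [folklore] -/
theorem su3_stringTension_onBallW_pv2_1_4 {mv : ℕ} (hmv : 1 ≤ mv) :
    ∃ C c : ℝ, 0 < c ∧ ∀ 𝓦 : PerturbationFamily 4 3,
      (∀ᶠ L : ℕ in atTop, 𝓦 L ∈ ClusterDomain (Real.log (6 / 5)) (2 * (57 / 200)) (57 / 200) ∧ IsSlabLocal mv (𝓦 L)) →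
        ∀ μ ∈ perturbedLimitPoints ((1 / 4 : ℝ) / 3) 𝓦,
          HasAreaLawWith μ (fun g => normalisedCharacter 3 (fundamentalRep (Fin 3) g)) C c ∧
          ((∃ σ : ℝ, HasStringTension μ (fun g => normalisedCharacter 3 (fundamentalRep (Fin 3) g)) σ) →
            c ≤ suFundStringTension 3 μ) :=
  suFundStringTension_ge_onBallW (su3_pv2RowW4_1_4 hmv)

/-- **`SU(3)`, `d = 4`, `β_W = 3/10`, TIER-2 ball `ClusterDomain (log 6/5) (.442) (.221)`, HYPOTHESIS-FREE**: the same reading, from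
`su3_pv2RowW4_3_10`. [folklore] -/
theorem su3_stringTension_onBallW_pv2_3_10 {mv : ℕ} (hmv : 1 ≤ mv) :
    ∃ C c : ℝ, 0 < c ∧ ∀ 𝓦 : PerturbationFamily 4 3,
      (∀ᶠ L : ℕ in atTop, 𝓦 L ∈ ClusterDomain (Real.log (6 / 5)) (2 * (221 / 1000)) (221 / 1000) ∧ IsSlabLocal mv (𝓦 L)) →
        ∀ μ ∈ perturbedLimitPoints ((3 / 10 : ℝ) / 3) 𝓦,
          HasAreaLawWith μ (fun g => normalisedCharacter 3 (fundamentalRep (Fin 3) g)) C c ∧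
          ((∃ σ : ℝ, HasStringTension μ (fun g => normalisedCharacter 3 (fundamentalRep (Fin 3) g)) σ) →
            c ≤ suFundStringTension 3 μ) :=
  suFundStringTension_ge_onBallW (su3_pv2RowW4_3_10 hmv)

/-- **`SU(3)`, `d = 4`, `β_W = 1/3`, TIER-2 ball `ClusterDomain (log 6/5) (.356) (.178)`, HYPOTHESIS-FREE**: the same reading, from
`su3_pv2RowW4_1_3`. [folklore] -/
theorem su3_stringTension_onBallW_pv2_1_3 {mv : ℕ} (hmv : 1 ≤ mv) :
    ∃ C c : ℝ, 0 < c ∧ ∀ 𝓦 : PerturbationFamily 4 3,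
      (∀ᶠ L : ℕ in atTop, 𝓦 L ∈ ClusterDomain (Real.log (6 / 5)) (2 * (89 / 500)) (89 / 500) ∧ IsSlabLocal mv (𝓦 L)) →
        ∀ μ ∈ perturbedLimitPoints ((1 / 3 : ℝ) / 3) 𝓦,
          HasAreaLawWith μ (fun g => normalisedCharacter 3 (fundamentalRep (Fin 3) g)) C c ∧
          ((∃ σ : ℝ, HasStringTension μ (fun g => normalisedCharacter 3 (fundamentalRep (Fin 3) g)) σ) →
            c ≤ suFundStringTension 3 μ) :=
  suFundStringTension_ge_onBallW (su3_pv2RowW4_1_3 hmv)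

/-- **`SU(3)`, `d = 4`, `β_W = 3/8`, TIER-2 ball `ClusterDomain (log 6/5) (.250) (.125)`, HYPOTHESIS-FREE**: the same reading, from
`su3_pv2RowW4_3_8`. [folklore] -/
theorem su3_stringTension_onBallW_pv2_3_8 {mv : ℕ} (hmv : 1 ≤ mv) :
    ∃ C c : ℝ, 0 < c ∧ ∀ 𝓦 : PerturbationFamily 4 3,
      (∀ᶠ L : ℕ in atTop, 𝓦 L ∈ ClusterDomain (Real.log (6 / 5)) (2 * (1 / 8)) (1 / 8) ∧ IsSlabLocal mv (𝓦 L)) →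
        ∀ μ ∈ perturbedLimitPoints ((3 / 8 : ℝ) / 3) 𝓦,
          HasAreaLawWith μ (fun g => normalisedCharacter 3 (fundamentalRep (Fin 3) g)) C c ∧
          ((∃ σ : ℝ, HasStringTension μ (fun g => normalisedCharacter 3 (fundamentalRep (Fin 3) g)) σ) →
            c ≤ suFundStringTension 3 μ) :=
  suFundStringTension_ge_onBallW (su3_pv2RowW4_3_8 hmv)

/-- **`SU(3)`, `d = 4`, `β_W = 2/5`, TIER-2 ball `ClusterDomain (log 6/5) (.184) (.092)`, HYPOTHESIS-FREE**: the same reading, from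
`su3_pv2RowW4_2_5`. [folklore] -/
theorem su3_stringTension_onBallW_pv2_2_5 {mv : ℕ} (hmv : 1 ≤ mv) :
    ∃ C c : ℝ, 0 < c ∧ ∀ 𝓦 : PerturbationFamily 4 3,
      (∀ᶠ L : ℕ in atTop, 𝓦 L ∈ ClusterDomain (Real.log (6 / 5)) (2 * (23 / 250)) (23 / 250) ∧ IsSlabLocal mv (𝓦 L)) →
        ∀ μ ∈ perturbedLimitPoints ((2 / 5 : ℝ) / 3) 𝓦,
          HasAreaLawWith μ (fun g => normalisedCharacter 3 (fundamentalRep (Fin 3) g)) C c ∧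
          ((∃ σ : ℝ, HasStringTension μ (fun g => normalisedCharacter 3 (fundamentalRep (Fin 3) g)) σ) →
            c ≤ suFundStringTension 3 μ) :=
  suFundStringTension_ge_onBallW (su3_pv2RowW4_2_5 hmv)

/-- **`SU(3)`, `d = 4`, `β_W = 21/50`, TIER-2 ball `ClusterDomain (log 6/5) (.132) (.066)`, HYPOTHESIS-FREE**: the same reading, from
`su3_pv2RowW4_21_50`. [folklore] -/
theorem su3_stringTension_onBallW_pv2_21_50 {mv : ℕ} (hmv : 1 ≤ mv) :
    ∃ C c : ℝ, 0 < c ∧ ∀ 𝓦 : PerturbationFamily 4 3,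
      (∀ᶠ L : ℕ in atTop, 𝓦 L ∈ ClusterDomain (Real.log (6 / 5)) (2 * (33 / 500)) (33 / 500) ∧ IsSlabLocal mv (𝓦 L)) →
        ∀ μ ∈ perturbedLimitPoints ((21 / 50 : ℝ) / 3) 𝓦,
          HasAreaLawWith μ (fun g => normalisedCharacter 3 (fundamentalRep (Fin 3) g)) C c ∧
          ((∃ σ : ℝ, HasStringTension μ (fun g => normalisedCharacter 3 (fundamentalRep (Fin 3) g)) σ) →
            c ≤ suFundStringTension 3 μ) :=
  suFundStringTension_ge_onBallW (su3_pv2RowW4_21_50 hmv)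

/-- **`SU(3)`, `d = 4`, `β_W = 43/100`, TIER-2 ball `ClusterDomain (log 6/5) (.106) (.053)`, HYPOTHESIS-FREE**: the same reading, from
`su3_pv2RowW4_43_100`. [folklore] -/
theorem su3_stringTension_onBallW_pv2_43_100 {mv : ℕ} (hmv : 1 ≤ mv) :
    ∃ C c : ℝ, 0 < c ∧ ∀ 𝓦 : PerturbationFamily 4 3,
      (∀ᶠ L : ℕ in atTop, 𝓦 L ∈ ClusterDomain (Real.log (6 / 5)) (2 * (53 / 1000)) (53 / 1000) ∧ IsSlabLocal mv (𝓦 L)) →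
        ∀ μ ∈ perturbedLimitPoints ((43 / 100 : ℝ) / 3) 𝓦,
          HasAreaLawWith μ (fun g => normalisedCharacter 3 (fundamentalRep (Fin 3) g)) C c ∧
          ((∃ σ : ℝ, HasStringTension μ (fun g => normalisedCharacter 3 (fundamentalRep (Fin 3) g)) σ) →
            c ≤ suFundStringTension 3 μ) :=
  suFundStringTension_ge_onBallW (su3_pv2RowW4_43_100 hmv)

/-- **`SU(3)`, `d = 4`, `β_W = 9/20`, TIER-2 ball `ClusterDomain (log 6/5) (.054) (.027)`, HYPOTHESIS-FREE**: the same reading, from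
`su3_pv2RowW4_9_20`. [folklore] -/
theorem su3_stringTension_onBallW_pv2_9_20 {mv : ℕ} (hmv : 1 ≤ mv) :
    ∃ C c : ℝ, 0 < c ∧ ∀ 𝓦 : PerturbationFamily 4 3,
      (∀ᶠ L : ℕ in atTop, 𝓦 L ∈ ClusterDomain (Real.log (6 / 5)) (2 * (27 / 1000)) (27 / 1000) ∧ IsSlabLocal mv (𝓦 L)) →
        ∀ μ ∈ perturbedLimitPoints ((9 / 20 : ℝ) / 3) 𝓦,
          HasAreaLawWith μ (fun g => normalisedCharacter 3 (fundamentalRep (Fin 3) g)) C c ∧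
          ((∃ σ : ℝ, HasStringTension μ (fun g => normalisedCharacter 3 (fundamentalRep (Fin 3) g)) σ) →
            c ≤ suFundStringTension 3 μ) :=
  suFundStringTension_ge_onBallW (su3_pv2RowW4_9_20 hmv)

/-! ### One ball for the whole segment (`d = 4`) and its string-tension reading -/

/-- **`SU(3)`, `d = 4`, HYPOTHESIS-FREE — ONE BALL FOR THE WHOLE SEGMENT**: for every Wilson coupling `0 ≤ β_W ≤ 12/25`, every range `r` and every
`mv ≥ 1`, `AreaLawOnBall 3 4 (β_W/3) (1/100) (1/200) r mv` (the PV2 pair certificate at the fixed radius `8/25` serves every smaller coupling;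
`τ = 609 / 500`, `K_s = 61381 / 20000`, `s₀ = 340207 / 250000`). [folklore] -/
theorem su3_pv2Row4_upTo_12_25 {βW : ℝ} (h0 : 0 ≤ βW) (h : βW ≤ 12 / 25) (r : ℕ) {mv : ℕ} (hmv : 1 ≤ mv) :
    AreaLawOnBall 3 4 (βW / 3) (2 * (1 / 200)) (1 / 200) r mv :=
  su3_areaLawOnBall_pv2 (n := 3) r hmv (ε := 1 / 200) (R := 8 / 25) (τ := 609 / 500) (Ks := 61381 / 20000) (s₀ := 340207 / 250000) h0
    (by push_cast; linarith) (by norm_num) (by norm_num) (by norm_num) (by norm_num) (by norm_num) (by norm_num) (by norm_num) (by norm_num)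
    (by push_cast; nlinarith [h, h0])

/-- **`SU(3)`, `d = 4`, HYPOTHESIS-FREE: string tension on the ball for the WHOLE SEGMENT `0 ≤ β_W ≤ 12/25`** on the fixed ball
`ClusterDomainFR (1/100) (1/200) r` — rb-p2's `suFundStringTension_ge_onBall` on `su3_pv2Row4_upTo_12_25`. [folklore] -/
theorem su3_stringTension_onBall_pv2_upTo_12_25 {βW : ℝ} (h0 : 0 ≤ βW) (h : βW ≤ 12 / 25) (r : ℕ) {mv : ℕ} (hmv : 1 ≤ mv) :
    ∃ C c : ℝ, 0 < c ∧ ∀ 𝓦 : PerturbationFamily 4 3,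
      (∀ᶠ L : ℕ in atTop, 𝓦 L ∈ ClusterDomainFR (2 * (1 / 200)) (1 / 200) r ∧ IsSlabLocal mv (𝓦 L)) →
        ∀ μ ∈ perturbedLimitPoints (βW / 3) 𝓦,
          HasAreaLawWith μ (fun g => normalisedCharacter 3 (fundamentalRep (Fin 3) g)) C c ∧
          ((∃ σ : ℝ, HasStringTension μ (fun g => normalisedCharacter 3 (fundamentalRep (Fin 3) g)) σ) →
            c ≤ suFundStringTension 3 μ) :=
  suFundStringTension_ge_onBall (su3_pv2Row4_upTo_12_25 h0 h r hmv)

end Summit.Ventures.YMGap.RobustBallPV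

end
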